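import Summits.MatrixMultiplication.MatrixMultiplication.Theorems.ConeTensor
import HarnessLib

/-!
# ConeTensorResidual — `T(K₄)_{n·n} ≤ ⟨n,n,n⟩ ⊠ W_n`, hence `2·ω(K₄) ≤ ω + ω(W)` and
`TetraNoSaving ⟹ ConeNoSaving`; grouping-class certificates for both «no saving» residuals

(decomp-mm lens 6 «barrier-complement carving», gen 14; kernel of the node `ConeCarving`.)

THE SCORE CLAIM OF THE NODE, in kernel. The tetrahedron carving (gen 13, route
`TetrahedronCarving`) cuts `ω = 2 ⟺ TetraFlat [ω(K₄) ≤ 4] ∧ TetraNoSaving [2ω ≤ ω(K₄)]`; the cone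
carving cuts `ω = 2 ⟺ ConeFlat [ω(W) ≤ 6] ∧ ConeNoSaving [3ω ≤ ω(W)]`. From the pointwise identity
`T(K₄)_{n·n} = ⟨n,n,n⟩_{rim} · W_n` (`ConeTensorCore.tetra_sq_eq_rim_mul_cone`) the rank-one
decompositions multiply: `R₄(T(K₄)_{n·n}) ≤ R(⟨n,n,n⟩) · R₄(W_n)` (`tensorRankD_tetra_sq_le_mul_cone`),
so `(β + γ)/2` is admissible for `T(K₄)` whenever `β` is for `⟨n,n,n⟩` and `γ` for `W`
(`mem_tetraAdmissibleExponents_of_cone`), i.e. **`2·ω(K₄) ≤ ω + ω(W)`**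
(`two_mul_omegaTetra_le_omega_add_omegaCone`). Consequently the residual got WEAKER:
**`TetraNoSaving ⟹ ConeNoSaving`** (`coneNoSaving_of_tetraNoSaving`: `2ω ≤ ω(K₄) ⟹ 3ω ≤ ω(W)`),
over every field.

GROUPING-CLASS CERTIFICATES. The only lower bounds available for `ω(K₄)` resp. `ω(W)` are
flattening/grouping bounds, the best of which are `ω(2,1,2) ≤ ω(K₄)` (gen 13) and `ω(4,2,2) ≤ ω(W)`
(`ConeTensor`). A proof of either residual THROUGH its grouping bound would prove the summit:
`2ω ≤ ω(2,1,2) ⟺ ω = 2` and `3ω ≤ ω(4,2,2) ⟺ ω = 2` (`…_iff` below; from Lotti–Romani subadditivity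
`ω(1,2,2) ≤ ω + 2`, `ω(1,1,2) ≤ ω + 1`). So both residuals need a rank lower bound for an explicit
4-tensor family beyond every grouping/flattening — or `ω = 2`. No `sorry`, no new axiom, no instance,
no notation, no `Prop`-valued definition.
-/

noncomputable section

set_option linter.dupNamespace false

open scoped BigOperators
open Filter Asymptotics Module
open Literature.Computability.AlgebraicComplexity
open Summit.MatrixMultiplication.MatrixMultiplication.Theorems.TetrahedronTensor

namespace Summit.MatrixMultiplication.MatrixMultiplication.Theorems.ConeTensor

/-! ## `R₄(T(K₄)_{n·n}) ≤ R(⟨n,n,n⟩) · R₄(W_n)` -/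

section Rank

variable {F : Type*} [Field F]

/-- **`R₄(T(K₄)_{n·n}) ≤ R(⟨n,n,n⟩) · R₄(W_n)`**: the products of a triad decomposition of the rim
triangle `⟨n,n,n⟩_{123}` with a rank-one decomposition of the cone `W_n` decompose `T(K₄)_{n·n}`
(pointwise `T(K₄)_{n·n} = ⟨n,n,n⟩_{rim} · W_n`). [cite: ChristandlVranaZuiddam2016, Prop. 1.1.16 (proof)] -/
theorem tensorRankD_tetra_sq_le_mul_cone (n : ℕ) :
    tensorRankD (tetra F (n * n)) ≤ tensorRank (matMulTensor F n n n) * tensorRankD (cone F n) := by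
  classical
  obtain ⟨w, u, v, hdec⟩ := exists_triad_decomposition_tensorRank (matMulTensor F n n n)
  obtain ⟨u', hu'⟩ := exists_rankOne_decomposition_cone (F := F) n
  have hMM : ∀ a b c, matMulTensor F n n n a b c =
      ∑ j : Fin (tensorRank (matMulTensor F n n n)), w j a * u j b * v j c := by
    intro a b c
    have h := congrFun (congrFun (congrFun hdec a) b) c
    rw [h, Finset.sum_apply, Finset.sum_apply, Finset.sum_apply]
    rfl
  let L : Fin (tensorRank (matMulTensor F n n n)) × Fin (tensorRankD (cone F n)) →
      Fin 4 → Fin ((n * n) ^ 3) → F := fun p =>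
    ![fun x => u' p.2 0 x,
      fun x => w p.1 (P₂ x 1, P₂ x 2) * u' p.2 1 x,
      fun x => u p.1 (P₂ x 1, P₂ x 2) * u' p.2 2 x,
      fun x => v p.1 (P₂ x 2, P₂ x 1) * u' p.2 3 x]
  have hsum : ∑ p, rankOneTensor (L p) = tetra F (n * n) := by
    funext i
    rw [Finset.sum_apply, Fintype.sum_prod_type, tetra_sq_eq_rim_mul_cone, hMM,
      ← congrFun hu' i, Finset.sum_apply, Finset.sum_mul_sum]
    refine Finset.sum_congr rfl fun j _ => Finset.sum_congr rfl fun k _ => ?_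
    rw [rankOneTensor_apply, rankOneTensor_apply, Fin.prod_univ_four, Fin.prod_univ_four]
    simp only [L, Matrix.cons_val_zero, Matrix.cons_val_one, Matrix.cons_val_two,
      Matrix.cons_val_three, Matrix.head_cons, Matrix.tail_cons]
    ring
  have hcard : Fintype.card
      (Fin (tensorRank (matMulTensor F n n n)) × Fin (tensorRankD (cone F n))) =
      tensorRank (matMulTensor F n n n) * tensorRankD (cone F n) := by simp
  rw [← hcard]
  let e := Fintype.equivFin
    (Fin (tensorRank (matMulTensor F n n n)) × Fin (tensorRankD (cone F n)))
  refine tensorRankD_le_of_eq_sum (fun k => L (e.symm k)) ?_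
  rw [← hsum]
  exact Fintype.sum_equiv e.symm _ _ (fun _ => rfl)

end Rank

/-! ## `2·ω(K₄) ≤ ω + ω(W)` and `TetraNoSaving ⟹ ConeNoSaving` -/

section Exponent

variable (F : Type*) [Field F]

/-- If `β` is admissible for `⟨n,n,n⟩` and `γ` for the cone, then `(β + γ)/2` is admissible for the
tetrahedron (`R₄(T(K₄)_m) ≤ R₄(T(K₄)_{N·N}) ≤ R(⟨N,N,N⟩)·R₄(W_N)` with `N = ⌊√m⌋ + 1`, `N² ≤ 4m`).
[cite: ChristandlVranaZuiddam2016, Prop. 1.1.16] -/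
theorem mem_tetraAdmissibleExponents_of_cone {β γ : ℝ} (hβ : β ∈ admissibleExponents F)
    (hγ : γ ∈ coneAdmissibleExponents F) : (β + γ) / 2 ∈ tetraAdmissibleExponents F := by
  have hβ2 : 2 ≤ β := admissibleExponents_two_le F hβ
  have hγ6 : 6 ≤ γ := six_le_of_mem_coneAdmissibleExponents F hγ
  have hpos : 0 ≤ (β + γ) / 2 := by linarith
  obtain ⟨C, hC0, hC⟩ := isBigO_iff'.1 hβ
  obtain ⟨D, hD0, hD⟩ := isBigO_iff'.1 hγ
  obtain ⟨N₀, hN₀⟩ := eventually_atTop.1 (hC.and hD)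
  refine IsBigO.of_bound (C * D * (4 : ℝ) ^ ((β + γ) / 2)) ?_
  filter_upwards [eventually_ge_atTop (max 1 (N₀ * N₀))] with m hm
  have hm1 : 1 ≤ m := le_trans (le_max_left _ _) hm
  have hmN : N₀ * N₀ ≤ m := le_trans (le_max_right _ _) hm
  set N := Nat.sqrt m + 1 with hNdef
  have hN₀N : N₀ ≤ N := by
    have : N₀ ≤ Nat.sqrt m := Nat.le_sqrt.2 hmN
    omega
  obtain ⟨hRN, hWN⟩ := hN₀ N hN₀N
  rw [Real.norm_of_nonneg (Nat.cast_nonneg _),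
    Real.norm_of_nonneg (Real.rpow_nonneg (Nat.cast_nonneg _) _)] at hRN hWN ⊢
  have hN0 : (0 : ℝ) ≤ N := Nat.cast_nonneg _
  have hNpos : (0 : ℝ) < N := by
    have : 1 ≤ N := by omega
    exact_mod_cast this
  -- naturals: `R₄(T_m) ≤ R₄(T_{N·N}) ≤ R(⟨N,N,N⟩)·R₄(W_N)` and `N·N ≤ 4m`
  have hnat : tensorRankD (tetra F m) ≤ tensorRank (matMulTensor F N N N) * tensorRankD (cone F N) :=
    (tensorRankD_tetra_mono ((Nat.le_succ m).trans (Nat.succ_le_succ_sqrt m))).trans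
      (tensorRankD_tetra_sq_le_mul_cone N)
  have hNN : N * N ≤ 4 * m := by
    have hs : 1 ≤ Nat.sqrt m := Nat.le_sqrt.2 (by simpa using hm1)
    have hs2 : Nat.sqrt m * Nat.sqrt m ≤ m := Nat.sqrt_le m
    nlinarith [hs, hs2]
  have step1 : (tensorRankD (tetra F m) : ℝ) ≤ (C * (N : ℝ) ^ β) * (D * (N : ℝ) ^ γ) := by
    calc (tensorRankD (tetra F m) : ℝ)
        ≤ ((tensorRank (matMulTensor F N N N) : ℕ) : ℝ) * ((tensorRankD (cone F N) : ℕ) : ℝ) := by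
          exact_mod_cast hnat
      _ ≤ (C * (N : ℝ) ^ β) * (D * (N : ℝ) ^ γ) :=
          mul_le_mul hRN hWN (Nat.cast_nonneg _) (by positivity)
  have step2 : (N : ℝ) ^ β * (N : ℝ) ^ γ = ((N : ℝ) ^ (2 : ℝ)) ^ ((β + γ) / 2) := by
    rw [← Real.rpow_add hNpos, ← Real.rpow_mul hN0]
    congr 1
    ring
  have step3 : ((N : ℝ) ^ (2 : ℝ)) ^ ((β + γ) / 2) ≤
      (4 : ℝ) ^ ((β + γ) / 2) * (m : ℝ) ^ ((β + γ) / 2) := by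
    calc ((N : ℝ) ^ (2 : ℝ)) ^ ((β + γ) / 2) ≤ ((4 * m : ℕ) : ℝ) ^ ((β + γ) / 2) := by
          refine Real.rpow_le_rpow (by positivity) ?_ hpos
          rw [Real.rpow_two]
          exact_mod_cast (by simpa [sq] using hNN : N ^ 2 ≤ 4 * m)
      _ = (4 : ℝ) ^ ((β + γ) / 2) * (m : ℝ) ^ ((β + γ) / 2) := by
          push_cast
          exact Real.mul_rpow (by norm_num) (Nat.cast_nonneg _)
  calc (tensorRankD (tetra F m) : ℝ) ≤ (C * (N : ℝ) ^ β) * (D * (N : ℝ) ^ γ) := step1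
    _ = C * D * ((N : ℝ) ^ β * (N : ℝ) ^ γ) := by ring
    _ = C * D * ((N : ℝ) ^ (2 : ℝ)) ^ ((β + γ) / 2) := by rw [step2]
    _ ≤ C * D * ((4 : ℝ) ^ ((β + γ) / 2) * (m : ℝ) ^ ((β + γ) / 2)) :=
        mul_le_mul_of_nonneg_left step3 (by positivity)
    _ = C * D * (4 : ℝ) ^ ((β + γ) / 2) * (m : ℝ) ^ ((β + γ) / 2) := by ring

/-- **`2·ω(K₄) ≤ ω + ω(W)`** — the tetrahedron is covered by the rim triangle and the squared-spoke
cone — for every field. [cite: ChristandlVranaZuiddam2016, Prop. 1.1.16] -/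
theorem two_mul_omegaTetra_le_omega_add_omegaCone :
    2 * omegaTetra F ≤ omega F + omegaCone F := by
  have h1 : ∀ γ ∈ coneAdmissibleExponents F, 2 * omegaTetra F - γ ≤ omega F := fun γ hγ => by
    refine le_csInf (admissibleExponents_nonempty F) fun β hβ => ?_
    have := csInf_le (tetraAdmissibleExponents_bddBelow F)
      (mem_tetraAdmissibleExponents_of_cone F hβ hγ)
    change omegaTetra F ≤ (β + γ) / 2 at this
    linarith
  have h2 : 2 * omegaTetra F - omega F ≤ omegaCone F :=
    le_csInf (coneAdmissibleExponents_nonempty F) fun γ hγ => by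
      have := h1 γ hγ
      linarith
  linarith

/-- **THE RESIDUAL GOT WEAKER: `TetraNoSaving ⟹ ConeNoSaving`** (`2ω ≤ ω(K₄) ⟹ 3ω ≤ ω(W)`), for
every field: nothing saved over two triangles ⟹ nothing saved over three. [folklore] -/
theorem coneNoSaving_of_tetraNoSaving (h : 2 * omega F ≤ omegaTetra F) :
    3 * omega F ≤ omegaCone F := by
  have := two_mul_omegaTetra_le_omega_add_omegaCone F
  linarith

/-- Contrapositive bookkeeping: a saving for the cone is a saving for the tetrahedron,
`ω(W) < 3ω ⟹ ω(K₄) < 2ω` (quantitatively `ω(K₄) ≤ (ω + ω(W))/2`). [folklore] -/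
theorem omegaTetra_lt_two_mul_omega_of_omegaCone_lt (h : omegaCone F < 3 * omega F) :
    omegaTetra F < 2 * omega F := by
  have := two_mul_omegaTetra_le_omega_add_omegaCone F
  linarith

/-- What `ConeFlat` gives for the tetrahedron through this cover alone: `ω(W) ≤ 6 ⟹ ω(K₄) ≤ 3 + ω/2`
(the full `ω(K₄) ≤ 4` needs the four apex-permuted cones, `⊠_v W^{(v)}_n = T(K₄)_{n⁶}`). [folklore] -/
theorem omegaTetra_le_of_omegaCone_le_six (h : omegaCone F ≤ 6) :
    omegaTetra F ≤ 3 + omega F / 2 := by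
  have := two_mul_omegaTetra_le_omega_add_omegaCone F
  linarith

end Exponent

/-! ## Grouping-class certificates: proving a residual through its grouping bound proves `ω = 2` -/

section Certificates

variable (F : Type) [Field F]

/-- `ω(1,1,2) ≤ ω + 1` (Lotti–Romani subadditivity with `ω(0,0,1) = 1`). [cite: LottiRomani1983, §1 (p. 173)] -/
theorem omegaRect_one_one_two_le_omega_add_one : omegaRect F 1 1 2 ≤ omega F + 1 := by
  have hsub := LottiRomani1983_subadditive F 1 1 1 0 0 1
  have h001 : omegaRect F 0 0 1 = 0 + 1 :=
    omegaRect_eq_add_of_nonpos₁ F (le_refl 0) (le_refl 0) zero_le_one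
  rw [omegaRect_one_one_one] at hsub
  norm_num at hsub h001
  linarith

/-- `ω(1,2,2) ≤ ω + 2` (Lotti–Romani subadditivity with `ω(0,1,1) = 2`). [cite: LottiRomani1983, §1 (p. 173)] -/
theorem omegaRect_one_two_two_le_omega_add_two : omegaRect F 1 2 2 ≤ omega F + 2 := by
  have hsub := LottiRomani1983_subadditive F 1 1 1 0 1 1
  have h011 : omegaRect F 0 1 1 = 1 + 1 :=
    omegaRect_eq_add_of_nonpos₁ F (le_refl 0) zero_le_one zero_le_one
  rw [omegaRect_one_one_one] at hsub
  norm_num at hsub h011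
  linarith

/-- `ω(4,2,2) ≤ 2ω + 2`: the grouping bound of the cone is within `2` of `2ω`, so it can certify
`ConeNoSaving : 3ω ≤ ω(W)` only if `ω ≤ 2`. [cite: LottiRomani1983, §1 (p. 173)] -/
theorem omegaRect_four_two_two_le : omegaRect F 4 2 2 ≤ 2 * omega F + 2 := by
  rw [omegaRect_four_two_two_eq F]
  have := omegaRect_one_one_two_le_omega_add_one F
  linarith

/-- **CERTIFICATE (cone)**: `3ω ≤ ω(4,2,2) ⟺ ω = 2` over `ℂ` — a proof of `ConeNoSaving` through the
grouping lower bound `ω(4,2,2) ≤ ω(W)` is a proof of the summit. [folklore] -/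
theorem three_mul_omega_le_omegaRect_four_two_two_iff :
    3 * omega ℂ ≤ omegaRect ℂ 4 2 2 ↔ _root_.MatrixMultiplication := by
  constructor
  · intro h
    have := omegaRect_four_two_two_le ℂ
    refine (_root_.MatrixMultiplication_iff).2 (le_antisymm ?_ (omega_two_le ℂ))
    linarith
  · intro hS
    have hω : omega ℂ = 2 := (_root_.MatrixMultiplication_iff).1 hS
    have := six_le_omegaRect_four_two_two ℂ
    rw [hω]
    linarith

/-- **CERTIFICATE (tetrahedron)**: `2ω ≤ ω(2,1,2) ⟺ ω = 2` over `ℂ` — a proof of `TetraNoSaving`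
(gen 13 residual) through the grouping lower bound `ω(2,1,2) ≤ ω(K₄)` is a proof of the summit.
[folklore] -/
theorem two_mul_omega_le_omegaRect_two_one_two_iff :
    2 * omega ℂ ≤ omegaRect ℂ 2 1 2 ↔ _root_.MatrixMultiplication := by
  constructor
  · intro h
    rw [omegaRect_swap₁₂ ℂ 2 1 2] at h
    have := omegaRect_one_two_two_le_omega_add_two ℂ
    refine (_root_.MatrixMultiplication_iff).2 (le_antisymm ?_ (omega_two_le ℂ))
    linarith
  · intro hS
    have hω : omega ℂ = 2 := (_root_.MatrixMultiplication_iff).1 hS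
    have := four_le_omegaRect_two_one_two ℂ
    rw [hω]
    linarith

end Certificates

end Summit.MatrixMultiplication.MatrixMultiplication.Theorems.ConeTensor

end
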